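import Mathlib
import Summits.ValiantsHypothesis.ValiantsHypothesis.Theorems.NewtonUnitEquationsTwoProductsPowerSumCriterion
/-! # Stub `stub_enginePencil` — crux `TwoProducts` (stmt-ValiantsHypothesis-5906), line `corner-log-linearization`
   The PENCIL RUNG of the engine: all tails are scalar multiples of one constant-free bivariate
   polynomial `h`.  Then `D = ∏ (1 + c_i h) - ∏ (1 + c'_i h) = R(h)` for the univariate polynomial
   `R = ∏ (1 + c_i X) - ∏ (1 + c'_i X)`, i.e. `D = ∑_k R_k • h ^ k`.  If `R = 0` there is nothing to
   prove; else let `k₀` be the trailing degree of `R`.  Fix a positive weight `w` and a strict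
   `w`-minimiser `e` of `supp D` (a south-west vertex).  Perturb `w` to the additive integer weight
   `ω = K • wt_w + x-coordinate` with `K` exceeding every `x`-coordinate occurring in
   `supp D ∪ supp h`; `ω` is injective on `supp h`, so `supp h` has a strict `ω`-minimiser `v`, and
   strict minimisers multiply: `k • v` is the strict `ω`-minimiser of `supp (h ^ k)` with coefficient
   `(h_v) ^ k`, while every point of `supp (h ^ k)` weighs at least `k • ω v` (`ω v ≥ 1` as `v ≠ 0`).
   Hence `k₀ • v` is the strict `ω`-minimiser of `supp D`.  As `ω` refines `wt_w` strictly on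
   `supp D`, the strict `w`-minimiser `e` must coincide with it: `e = k₀ • v`.  So the vertex set lies
   in `k₀ • supp h`, whose cardinality is at most `|supp h|`. [folklore] -/
set_option linter.dupNamespace false -- single-conjunct summit: `ValiantsHypothesis.ValiantsHypothesis`
namespace Summit.ValiantsHypothesis.ValiantsHypothesis.Theorems.TwoProducts.Pencil
open scoped BigOperators
open MvPolynomial
open Summit.ValiantsHypothesis.ValiantsHypothesis.Theorems.TwoProducts.PowerSum

/-- Strict minimisers of an additive weight multiply: if `a`, `b` are the unique `ω`-lightest support
points of `A`, `B`, then `a + b` is the unique `ω`-lightest support point of `A * B`, with coefficient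
`A_a * B_b`. [folklore] -/
theorem strictMin_mul (ω : (Fin 2 →₀ ℕ) → ℤ) (hadd : ∀ p q, ω (p + q) = ω p + ω q)
    (A B : MvPolynomial (Fin 2) ℂ) (a b : Fin 2 →₀ ℕ)
    (ha : a ∈ A.support) (hamin : ∀ p ∈ A.support, p ≠ a → ω a < ω p)
    (hb : b ∈ B.support) (hbmin : ∀ q ∈ B.support, q ≠ b → ω b < ω q) :
    coeff (a + b) (A * B) = coeff a A * coeff b B ∧ (a + b) ∈ (A * B).support ∧
      ∀ q ∈ (A * B).support, q ≠ a + b → ω (a + b) < ω q := by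
  classical
  have hale : ∀ p ∈ A.support, ω a ≤ ω p := fun p hp =>
    (eq_or_ne p a).elim (fun h => h ▸ le_rfl) fun h => (hamin p hp h).le
  have hble : ∀ q ∈ B.support, ω b ≤ ω q := fun q hq =>
    (eq_or_ne q b).elim (fun h => h ▸ le_rfl) fun h => (hbmin q hq h).le
  have hcoeff : coeff (a + b) (A * B) = coeff a A * coeff b B := by
    rw [coeff_mul, Finset.sum_eq_single_of_mem (a, b) (by simp)]
    rintro ⟨p, q⟩ hx hne
    have hpq : p + q = a + b := Finset.HasAntidiagonal.mem_antidiagonal.mp hx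
    by_contra hne0
    have hp : p ∈ A.support := mem_support_iff.mpr (left_ne_zero_of_mul hne0)
    have hq : q ∈ B.support := mem_support_iff.mpr (right_ne_zero_of_mul hne0)
    have hw : ω p + ω q = ω a + ω b := by rw [← hadd, ← hadd, hpq]
    rcases eq_or_ne p a with rfl | hpa
    · exact hne (Prod.ext rfl (add_left_cancel hpq))
    · linarith [hamin p hp hpa, hble q hq]
  refine ⟨hcoeff, ?_, ?_⟩
  · rw [mem_support_iff, hcoeff]
    exact mul_ne_zero (mem_support_iff.mp ha) (mem_support_iff.mp hb)
  · intro q hq hne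
    obtain ⟨p, hp, p', hp', rfl⟩ := Finset.mem_add.mp (support_mul _ _ hq)
    rw [hadd, hadd]
    rcases eq_or_ne p a with rfl | hpa
    · have hp'b : p' ≠ b := fun h => hne (by rw [h])
      linarith [hbmin p' hp' hp'b]
    · linarith [hamin p hp hpa, hble p' hp']

/-- Powers of a strict minimiser: if `v` is the unique `ω`-lightest support point of `h`, then `k • v`
is the unique `ω`-lightest support point of `h ^ k`, with coefficient `(h_v) ^ k`. [folklore] -/
theorem strictMin_pow (ω : (Fin 2 →₀ ℕ) → ℤ) (hadd : ∀ p q, ω (p + q) = ω p + ω q)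
    (h : MvPolynomial (Fin 2) ℂ) (v : Fin 2 →₀ ℕ) (hv : v ∈ h.support)
    (hvmin : ∀ p ∈ h.support, p ≠ v → ω v < ω p) (k : ℕ) :
    coeff (k • v) (h ^ k) = coeff v h ^ k ∧ (k • v) ∈ (h ^ k).support ∧
      ∀ q ∈ (h ^ k).support, q ≠ k • v → ω (k • v) < ω q := by
  classical
  induction k with
  | zero =>
    refine ⟨by rw [zero_nsmul, pow_zero, pow_zero, coeff_zero_one], ?_, ?_⟩
    · rw [zero_nsmul, pow_zero, mem_support_iff, coeff_zero_one]
      exact one_ne_zero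
    · intro q hq hne
      rw [pow_zero, mem_support_iff, coeff_one] at hq
      split_ifs at hq with h'
      · exact absurd (by rw [← h', zero_nsmul]) hne
      · exact absurd rfl hq
  | succ k ih =>
    obtain ⟨hc, hmem, hmin⟩ := ih
    obtain ⟨hc', hmem', hmin'⟩ := strictMin_mul ω hadd (h ^ k) h (k • v) v hmem hmin hv hvmin
    rw [pow_succ, succ_nsmul]
    exact ⟨by rw [hc', hc, pow_succ], hmem', hmin'⟩

/-- If every support point of `h` weighs at least `m`, every support point of `h ^ k` weighs at
least `k * m`. [folklore] -/
theorem mul_le_wt_of_mem_support_pow (ω : (Fin 2 →₀ ℕ) → ℤ)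
    (hadd : ∀ p q, ω (p + q) = ω p + ω q) (h : MvPolynomial (Fin 2) ℂ) (m : ℤ)
    (hm : ∀ p ∈ h.support, m ≤ ω p) :
    ∀ (k : ℕ) (q : Fin 2 →₀ ℕ), q ∈ (h ^ k).support → (k : ℤ) * m ≤ ω q := by
  classical
  intro k
  induction k with
  | zero =>
    intro q hq
    rw [pow_zero, mem_support_iff, coeff_one] at hq
    split_ifs at hq with h'
    · simp [← h', wt_zero ω hadd]
    · exact absurd rfl hq
  | succ k ih =>
    intro q hq
    obtain ⟨a, ha, b, hb, rfl⟩ := Finset.mem_add.mp (support_mul _ _ (pow_succ h k ▸ hq))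
    rw [hadd]
    push_cast
    linarith [ih a ha, hm b hb]

/-- An additive weight is linear on multiples: `ω (k • v) = k * ω v`. [folklore] -/
theorem wt_nsmul (ω : (Fin 2 →₀ ℕ) → ℤ) (hadd : ∀ p q, ω (p + q) = ω p + ω q)
    (v : Fin 2 →₀ ℕ) (k : ℕ) : ω (k • v) = (k : ℤ) * ω v := by
  induction k with
  | zero => simp [wt_zero ω hadd]
  | succ k ih =>
    rw [succ_nsmul, hadd, ih]
    push_cast
    ring

/-- The pencil expansion has a unique lightest point: if `v` is the unique `ω`-lightest support point
of `h` with `ω v > 0`, and `d k = 0` for `k < k₀` while `d k₀ ≠ 0` (`k₀ < M`), then `k₀ • v` is the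
unique `ω`-lightest support point of `∑_{k < M} d k • h ^ k`. [folklore] -/
theorem strictMin_sum_smul_pow (ω : (Fin 2 →₀ ℕ) → ℤ) (hadd : ∀ p q, ω (p + q) = ω p + ω q)
    (h : MvPolynomial (Fin 2) ℂ) (v : Fin 2 →₀ ℕ) (hv : v ∈ h.support)
    (hvmin : ∀ p ∈ h.support, p ≠ v → ω v < ω p) (hvpos : 0 < ω v)
    (d : ℕ → ℂ) (M k₀ : ℕ) (hk₀M : k₀ < M) (hd0 : ∀ k < k₀, d k = 0) (hdk₀ : d k₀ ≠ 0) :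
    (k₀ • v) ∈ (∑ k ∈ Finset.range M, d k • h ^ k).support ∧
      ∀ q ∈ (∑ k ∈ Finset.range M, d k • h ^ k).support, q ≠ k₀ • v → ω (k₀ • v) < ω q := by
  classical
  have hvle : ∀ p ∈ h.support, ω v ≤ ω p := fun p hp =>
    (eq_or_ne p v).elim (fun h => h ▸ le_rfl) fun h => (hvmin p hp h).le
  have hpow := strictMin_pow ω hadd h v hv hvmin
  have hlow := mul_le_wt_of_mem_support_pow ω hadd h (ω v) hvle
  -- above the trailing index the coefficient at `k₀ • v` vanishes
  have hvanish : ∀ k, k₀ < k → coeff (k₀ • v) (h ^ k) = 0 := by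
    intro k hk
    by_contra hne
    have h1 := hlow k _ (mem_support_iff.mpr hne)
    rw [wt_nsmul ω hadd] at h1
    have hk' : (k₀ : ℤ) + 1 ≤ k := by exact_mod_cast hk
    have h2 := mul_le_mul_of_nonneg_right hk' hvpos.le
    linarith
  have hcoeff : coeff (k₀ • v) (∑ k ∈ Finset.range M, d k • h ^ k) = d k₀ * coeff v h ^ k₀ := by
    rw [coeff_sum, Finset.sum_eq_single_of_mem k₀ (Finset.mem_range.mpr hk₀M)]
    · rw [coeff_smul, (hpow k₀).1, smul_eq_mul]
    · intro k _ hne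
      rcases lt_or_gt_of_ne hne with hlt | hgt
      · rw [hd0 k hlt, zero_smul, coeff_zero]
      · rw [coeff_smul, hvanish k hgt, smul_zero]
  refine ⟨?_, ?_⟩
  · rw [mem_support_iff, hcoeff]
    exact mul_ne_zero hdk₀ (pow_ne_zero _ (mem_support_iff.mp hv))
  · intro q hq hne
    obtain ⟨k, -, hqk⟩ := Finset.mem_biUnion.mp (support_sum hq)
    have hqk' : q ∈ (h ^ k).support := support_smul hqk
    rcases lt_trichotomy k k₀ with hlt | rfl | hgt
    · rw [hd0 k hlt, zero_smul] at hqk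
      simp at hqk
    · exact (hpow _).2.2 q hqk' hne
    · have h1 := hlow k q hqk'
      rw [wt_nsmul ω hadd]
      have hk' : (k₀ : ℤ) + 1 ≤ k := by exact_mod_cast hgt
      have h2 := mul_le_mul_of_nonneg_right hk' hvpos.le
      linarith

/-- Separation by a large scale: if `0 ≤ x < K`, `0 ≤ y` and `a < b` (integers), then
`K * a + x < K * b + y`. [folklore] -/
theorem K_separates {K a b x y : ℤ} (hx0 : 0 ≤ x) (hxK : x < K) (hy0 : 0 ≤ y) (hab : a < b) :
    K * a + x < K * b + y := by
  have hK : 0 ≤ K := by linarith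
  have hab' : a + 1 ≤ b := by omega
  have := mul_le_mul_of_nonneg_left hab' hK
  linarith

/-- **Core of the pencil rung.** For `h ≠ 0` constant-free and `D = ∑_{k < M} d k • h ^ k` with
trailing index `k₀` (`d k = 0` for `k < k₀`, `d k₀ ≠ 0`), every south-west vertex `e` of `D`
(a strict minimiser over `supp D` of a linear form with positive weights) is `k₀ • v` for a support
point `v` of `h`. [folklore] -/
theorem vertex_eq_smul (h : MvPolynomial (Fin 2) ℂ) (h0 : coeff 0 h = 0) (hh : h ≠ 0)
    (d : ℕ → ℂ) (M k₀ : ℕ) (hk₀M : k₀ < M) (hd0 : ∀ k < k₀, d k = 0) (hdk₀ : d k₀ ≠ 0)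
    (w : Fin 2 → ℤ) (hw0 : 0 < w 0) (hw1 : 0 < w 1) (e : Fin 2 →₀ ℕ)
    (he : e ∈ (∑ k ∈ Finset.range M, d k • h ^ k).support)
    (hmin : ∀ e' ∈ (∑ k ∈ Finset.range M, d k • h ^ k).support, e' ≠ e →
      w 0 * (e 0 : ℤ) + w 1 * (e 1 : ℤ) < w 0 * (e' 0 : ℤ) + w 1 * (e' 1 : ℤ)) :
    ∃ v ∈ h.support, k₀ • v = e := by
  classical
  -- a scale `K` exceeding every `x`-coordinate in `supp D ∪ supp h`
  obtain ⟨K, hK1, hKlt⟩ : ∃ K : ℤ, 1 ≤ K ∧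
      ∀ q ∈ (∑ k ∈ Finset.range M, d k • h ^ k).support ∪ h.support, ((q 0 : ℕ) : ℤ) < K := by
    refine ⟨(((∑ k ∈ Finset.range M, d k • h ^ k).support ∪ h.support).sup (fun q => q 0) : ℕ) + 1,
      le_add_of_nonneg_left (Nat.cast_nonneg _), fun q hq => ?_⟩
    have hle : q 0 ≤ ((∑ k ∈ Finset.range M, d k • h ^ k).support ∪ h.support).sup (fun q => q 0) :=
      Finset.le_sup (f := fun q : Fin 2 →₀ ℕ => q 0) hq
    exact_mod_cast Nat.lt_succ_of_le hle
  -- the perturbed weight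
  obtain ⟨ω, hω⟩ : ∃ ω : (Fin 2 →₀ ℕ) → ℤ,
      ∀ q, ω q = K * (w 0 * (q 0 : ℤ) + w 1 * (q 1 : ℤ)) + (q 0 : ℤ) := ⟨_, fun q => rfl⟩
  have hadd : ∀ p q, ω (p + q) = ω p + ω q := by
    intro p q
    simp only [hω, Finsupp.coe_add, Pi.add_apply, Nat.cast_add]
    ring
  obtain ⟨v, hv, hvle⟩ := Finset.exists_min_image h.support ω (support_nonempty.mpr hh)
  have hvK : ((v 0 : ℕ) : ℤ) < K := hKlt v (Finset.mem_union_right _ hv)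
  -- `v` is the STRICT `ω`-minimiser of `supp h`: `ω` is injective on `supp h`
  have hvmin : ∀ p ∈ h.support, p ≠ v → ω v < ω p := by
    intro p hp hpv
    refine lt_of_le_of_ne (hvle p hp) fun heq => hpv ?_
    have hpK : ((p 0 : ℕ) : ℤ) < K := hKlt p (Finset.mem_union_right _ hp)
    rw [hω, hω] at heq
    have hwt : w 0 * (v 0 : ℤ) + w 1 * (v 1 : ℤ) = w 0 * (p 0 : ℤ) + w 1 * (p 1 : ℤ) := by
      by_contra hne
      rcases lt_or_gt_of_ne hne with hlt | hlt
      · exact absurd heq (K_separates (Nat.cast_nonneg _) hvK (Nat.cast_nonneg _) hlt).ne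
      · exact absurd heq.symm (K_separates (Nat.cast_nonneg _) hpK (Nat.cast_nonneg _) hlt).ne
    have hx0 : ((p 0 : ℕ) : ℤ) = v 0 := by rw [hwt] at heq; linarith
    have hx1 : ((p 1 : ℕ) : ℤ) = v 1 := by
      rw [← hx0] at hwt
      have h2 : w 1 * ((p 1 : ℕ) : ℤ) = w 1 * (v 1 : ℤ) := by linarith
      exact mul_left_cancel₀ hw1.ne' h2
    ext i
    fin_cases i
    · exact_mod_cast hx0
    · exact_mod_cast hx1
  -- `ω v > 0` since `v ≠ 0`
  have hvpos : 0 < ω v := by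
    have hv0 : v ≠ 0 := by
      rintro rfl
      exact (mem_support_iff.mp hv) h0
    have hsum : v 0 ≠ 0 ∨ v 1 ≠ 0 := by
      by_contra hcon
      push Not at hcon
      exact hv0 (by ext i; fin_cases i <;> simp [hcon.1, hcon.2])
    have hsum' : (1 : ℤ) ≤ (v 0 : ℤ) + (v 1 : ℤ) := by omega
    have h01 : ((v 0 : ℕ) : ℤ) ≤ w 0 * (v 0 : ℤ) := le_mul_of_one_le_left (Nat.cast_nonneg _) (by omega)
    have h11 : ((v 1 : ℕ) : ℤ) ≤ w 1 * (v 1 : ℤ) := le_mul_of_one_le_left (Nat.cast_nonneg _) (by omega)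
    have hS : (0 : ℤ) ≤ w 0 * (v 0 : ℤ) + w 1 * (v 1 : ℤ) := by linarith
    have hKS := le_mul_of_one_le_left hS hK1
    have hv0nn : (0 : ℤ) ≤ (v 0 : ℕ) := Nat.cast_nonneg _
    rw [hω]
    linarith
  obtain ⟨hmem, hstrict⟩ :=
    strictMin_sum_smul_pow ω hadd h v hv hvmin hvpos d M k₀ hk₀M hd0 hdk₀
  refine ⟨v, hv, ?_⟩
  by_contra hne
  have h1 := hmin (k₀ • v) hmem hne
  have h2 := hstrict e he (Ne.symm hne)
  have heK : ((e 0 : ℕ) : ℤ) < K := hKlt e (Finset.mem_union_left _ he)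
  have h3 := K_separates (K := K) (Nat.cast_nonneg _) heK (Nat.cast_nonneg ((k₀ • v) 0)) h1
  rw [hω, hω] at h2
  exact lt_asymm h3 h2

/-- **Pencil rung** (rung `stub_enginePencil`, registered signature): if all tails are scalar
multiples `c_i • h`, `c'_i • h` of one constant-free polynomial `h`, then
`∏ (1 + c_i h) - ∏ (1 + c'_i h)` has at most `|supp h|` south-west vertices. [folklore] -/
theorem stub_enginePencil : ∀ (n : ℕ) (h : MvPolynomial (Fin 2) ℂ) (c c' : Fin n → ℂ), MvPolynomial.coeff 0 h = 0 → {e : Fin 2 →₀ ℕ | ∃ w : Fin 2 → ℤ, 0 < w 0 ∧ 0 < w 1 ∧ e ∈ ((∏ i, (1 + MvPolynomial.C (c i) * h)) - ∏ i, (1 + MvPolynomial.C (c' i) * h)).support ∧ ∀ e' ∈ ((∏ i, (1 + MvPolynomial.C (c i) * h)) - ∏ i, (1 + MvPolynomial.C (c' i) * h)).support, e' ≠ e → w 0 * (e 0 : ℤ) + w 1 * (e 1 : ℤ) < w 0 * (e' 0 : ℤ) + w 1 * (e' 1 : ℤ)}.ncard ≤ h.support.card := by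
  intro n h c c' h0
  classical
  by_cases hh : h = 0
  · subst hh
    simp
  -- the univariate pencil polynomial `R`, with `D = R(h) = ∑ R_k • h ^ k`
  set R : Polynomial ℂ := (∏ i, (1 + Polynomial.C (c i) * Polynomial.X)) -
    ∏ i, (1 + Polynomial.C (c' i) * Polynomial.X) with hR
  have hDR : (∏ i, (1 + MvPolynomial.C (c i) * h)) - ∏ i, (1 + MvPolynomial.C (c' i) * h) =
      ∑ k ∈ Finset.range (R.natDegree + 1), R.coeff k • h ^ k := by
    rw [← Polynomial.aeval_eq_sum_range]
    simp only [hR, map_sub, map_prod, map_add, map_one, map_mul, Polynomial.aeval_C,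
      Polynomial.aeval_X, MvPolynomial.algebraMap_eq]
  rw [hDR]
  by_cases hRz : R = 0
  · simp [hRz]
  have hk₀ : R.coeff R.natTrailingDegree ≠ 0 :=
    Polynomial.mem_support_iff.mp (Polynomial.natTrailingDegree_mem_support_of_nonzero hRz)
  have hlt : ∀ k < R.natTrailingDegree, R.coeff k = 0 := fun k hk =>
    Polynomial.coeff_eq_zero_of_lt_natTrailingDegree hk
  have hk₀M : R.natTrailingDegree < R.natDegree + 1 :=
    Nat.lt_succ_of_le (Polynomial.natTrailingDegree_le_natDegree R)
  have hsub : {e : Fin 2 →₀ ℕ | ∃ w : Fin 2 → ℤ, 0 < w 0 ∧ 0 < w 1 ∧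
      e ∈ (∑ k ∈ Finset.range (R.natDegree + 1), R.coeff k • h ^ k).support ∧
      ∀ e' ∈ (∑ k ∈ Finset.range (R.natDegree + 1), R.coeff k • h ^ k).support, e' ≠ e →
        w 0 * (e 0 : ℤ) + w 1 * (e 1 : ℤ) < w 0 * (e' 0 : ℤ) + w 1 * (e' 1 : ℤ)} ⊆
      (fun v => R.natTrailingDegree • v) '' ↑h.support := by
    rintro e ⟨w, hw0, hw1, he, hmin⟩
    obtain ⟨v, hv, hve⟩ := vertex_eq_smul h h0 hh R.coeff (R.natDegree + 1) R.natTrailingDegree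
      hk₀M hlt hk₀ w hw0 hw1 e he hmin
    exact ⟨v, Finset.mem_coe.mpr hv, hve⟩
  calc _ ≤ ((fun v => R.natTrailingDegree • v) '' ↑h.support).ncard :=
        Set.ncard_le_ncard hsub (h.support.finite_toSet.image _)
    _ ≤ (↑h.support : Set (Fin 2 →₀ ℕ)).ncard := Set.ncard_image_le h.support.finite_toSet
    _ = h.support.card := Set.ncard_coe_finset _

end Summit.ValiantsHypothesis.ValiantsHypothesis.Theorems.TwoProducts.Pencil
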